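import Summits.BirchSwinnertonDyer.Rank1Residual.Supersingular.RankZeroKimTamDefectRecords
import Summits.BirchSwinnertonDyer.Rank1Residual.Supersingular.X6KuriharaOfferShape
import HarnessLib

/-!
# N6 (X8 ∧ `r_an = 0` ∧ surj(3), `3 ∤ ∏c_ℓ`) PER-PAIR OFFER SHAPE at `p = 3`: `BSD(E,3)` from the literal integer equation,
# a LANDED `CertifiedOddL` twist record + rounding certificate, KERNEL certificates for everything decidable (minimality,
# class X8, surj(3), the cyclic Kolyvagin level from point counts + cube tests, the discrete logarithms), and EXACTLY the
# binders {Kim 2025 Thm 1.1 (OPEN), Wuthrich Prop. 21, period at 3, GZK, modularity, `D`, `r_an = 0`, the `L`-value enclosure}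

Cell `b2b-bsdres`, supersingular family, prover B = unit `b2b-bsdres-additive-p3` (gen 22), N6 class lead; the `p = 3` / X8
twin of prover A's `X6KuriharaOfferShape.lean` (x10b gen 12, p ≥ 5, class X6).  Topic file; namespace
`Summit.BirchSwinnertonDyer.Rank1Residual.Supersingular`.  THEOREMS ONLY (compositions of tree theorems by name);
no named fact, no definition, nothing asserted about any curve, nothing booked; X8 stays CONSTRUCTION-SHAPED
(RESIDUAL-MAP §I N6 mark unchanged).

HONEST FRAMING (run/shared/lean/b2b/bsd-rank1-residual/, verbatim in every file): the goal of the
cell is to DELETE the COMBINATION-SHAPED residual classes of the Birch–Swinnerton-Dyer formula for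
ALL analytic-rank `≤ 1` elliptic curves over `ℚ` — "full BSD formula for every rank `≤ 1` curve in
class `C`" assembled STRICTLY from published theorems — so that the rank-`≤ 1` remainder becomes
exactly the CONSTRUCTION-SHAPED classes, which are TYPED (missing-input `Prop`s), NOT attempted.
This is not "finishing BSD".  EVERY theorem here is CONDITIONAL on the ANNOUNCED preprint C.-H. Kim
(app. R. Pollack), arXiv:2505.09121 Thm. 1.1 (`hK25s`, OPEN binder) — a typed OPEN hypothesis, never a theorem.

## What this file proves

* **`X8RankZero.bsdp_three_of_kim2025_OPEN_of_ainvs_of_certifiedOddL_of_LValueBall`** — the RECORD SHAPE.  Input per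
  pair, all DECIDED IN THE KERNEL at instantiation: the literal `[a₁,a₂,a₃,a₄,a₆]` with its global minimality
  (`hmin`, x11c's bounded Kraus/Silverman criterion or gen 20's criterion₃), `3 ∤ Δ`, `countPoints … 3 ∈ {1,7}` (class X8,
  gen 20's `classX8_of_intModel`), `surj(3)` (gen 21's certificate `surj_x8r0_<label>_3`); the level `r.n = ℓ₁ℓ₂` of a
  LANDED `CertifiedOddL` row `r` (`r.p = 3`, two primes) READ OFF POINT COUNTS AND CUBE TESTS (`ℓᵢ ≥ 5`, `ℓᵢ ∤ Δ`,
  `ℓᵢ ≡ 1 (3)`, `#Ẽ(𝔽_ℓᵢ) = mᵢ`, `3 ∣ mᵢ`, `(Δ : ℤ/ℓᵢ) ≠ 0`, `(Δ : ℤ/ℓᵢ)^{(ℓᵢ−1)/3} ≠ 1` — gen 21's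
  `isCyclicKolyvaginLevel_pair_of_intModel_of_cube`, n1011-p03 / n1011-p15 underneath: `ℓ₁ℓ₂ ∈ 𝒩₁` with CYCLIC `3`-parts,
  exactly Kim's hypothesis); `A = (ℓ₁+1−m₁−2)(ℓ₂+1−m₂−2) = Π(a_ℓ − 2)` (prover A's
  `prod_primeFactors_frobeniusTrace_sub_two_eq`); a rounding certificate `c` passing `validHasse` and matching `r`; the
  discrete logarithms `ψᵢ : (ℤ/ℓᵢ)ˣ ↠ ℤ/3` (surjective; per pair `dlogChar ℓᵢ 3 ηᵢ` of the recorded least primitive roots).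
  REMAINING HYPOTHESES = EXACTLY: `hK25s` (Kim 2025 Thm 1.1, OPEN), the named PUBLISHED facts `hW` (Wuthrich Prop. 21),
  `hGZK`, `hmod`, `h3per` (period at `3`); the modular parametrisation `D` (newform `D.f`); the data binder `r_an = 0`
  (Cremona `allbsd`); and **`hballL`** — the engine's enclosure of
  `D'·c_∞·re(A·L(E,1) + Σ_{j≠0} e_3(−jk)·τ(χ_j)·L_j(1))/(3·Ω⁺_f)` for all holomorphic continuations `L_j` of the twisted
  `L`-series (implementation 3d; prover A's `CertifiedOddL.kuriharaNumber_ne_zero_of_LValueBall`, p305898, inside gen 21's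
  `X8RankZero.bsdp_three_of_kim2025_OPEN_of_certifiedOddL_of_LValueBall`, p306705, unit level `k = 1 ≤ ord₃∏c_ℓ + 1`).
  Conclusion `BSDp W 3`.  No Tamagawa binder (a level-1 number suffices whatever `ord₃∏c_ℓ` is).
Per pair; NOT a class theorem; nothing booked (records built on this shape are OFFERS for referee A).

References: `GoodSSTowerOfSurj.lean` (gen 21), `RankZeroKimTamDefectRecords.lean` §1 (gen 21), `X6KuriharaOfferShape.lean`,
`KuriharaTwistRecordGenericLValues.lean`, `KuriharaTwistDlogChar.lean` (x10b gen 12); C.-H. Kim (app. R. Pollack)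
arXiv:2505.09121 Thm. 1.1 [Kim2025RefinedTNC, ANNOUNCED]; C.-H. Kim, Amer. J. Math. 148 (2026) §1.2.2, §1.4.3
[Kim2022StructureSelmer]; [Wuthrich2014] Lemma 20, Prop. 21; [MazurTateTeitelbaum1986Invent] §I.8; [CremonaAlgorithms1997]
§2.8; [SilvermanAEC2009] III.1, VII.1, VII.5; [IrelandRosen1990] Prop. 5.1.2; [Miller2011LMS] Def. 1.1.
-/

set_option autoImplicit false

noncomputable section

open scoped Classical MatrixGroups ModularForm

open CongruenceSubgroup WeierstrassCurve Literature.NumberTheory.EllipticCurves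
  Literature.NumberTheory.EllipticCurves.ModularForms
  Literature.NumberTheory.EllipticCurves.Rank1Residual
  Literature.NumberTheory.EllipticCurves.Rank1Residual.Typed
  Literature.NumberTheory.EllipticCurves.Rank1Residual.X11RankOneCertificates
  Literature.NumberTheory.EllipticCurves.Wuthrich2014
  Summit.BirchSwinnertonDyer.BirchSwinnertonDyer.Rank1Residual.IntModel
  Summit.BirchSwinnertonDyer.BirchSwinnertonDyer.Rank1Residual.X11RankOne
  Summit.BirchSwinnertonDyer.Rank1Residual.X11b
  Summit.BirchSwinnertonDyer.Rank1Residual.Additive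
  Summit.BirchSwinnertonDyer.Rank1Residual.Supersingular.KuriharaTwist

namespace Summit.BirchSwinnertonDyer.Rank1Residual.Supersingular

/-- **N6 RECORD SHAPE — `BSD(E,3)` on X8 ∧ `r_an = 0` ∧ surj(3) from the literal equation, a landed `CertifiedOddL` twist
record + rounding certificate, kernel certificates, and the `L`-value enclosure.**  `[a₁,…,a₆]` with `hmin` (global
minimality, explicit); decidable inputs: `3 ∤ Δ`, `countPoints … 3 = n₃ ∈ {1,7}` (class X8); `hsurj` = gen 21's surj(3)
certificate; the landed `CertifiedOddL` row `r` (`r.p = 3`, `r.primes.length = 2`) whose level `r.n = ℓ₁ℓ₂` is read off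
the model: `ℓᵢ ≥ 5`, `ℓᵢ ∤ Δ`, `ℓᵢ ≡ 1 (mod 3)`, `#(E mod ℓᵢ)(𝔽_ℓᵢ) = mᵢ` with `3 ∣ mᵢ` (Kolyvagin), cube tests
`(Δ : ℤ/ℓᵢ) ≠ 0`, `(Δ : ℤ/ℓᵢ)^{(ℓᵢ−1)/3} ≠ 1` (cyclic `3`-part) and `A = (ℓ₁+1−m₁−2)(ℓ₂+1−m₂−2)` (`= Π(a_ℓ − 2)`); a
rounding certificate `c` passing `validHasse` and matching `r`; surjective discrete logarithms `ψ₁, ψ₂`.  REMAINING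
HYPOTHESES = EXACTLY `hK25s` (OPEN), `hW`, `hGZK`, `hmod`, `h3per` (PUBLISHED), `D`, `r_an = 0`, and `hballL`, the engine's
enclosure of `D'·c_∞·re(A·L(E,1) + Σ_{j≠0} e_3(−jk)·τ(χ_j)·L_j(1))/(3·Ω⁺_f)`.  Per pair; NOT a class theorem; nothing
booked. [claim: Kim2025RefinedTNC, status: under-review] [cite: Kim2025RefinedTNC, Thm. 1.1, §8.1.2 (ANNOUNCED, OPEN binder)]
[cite: Kim2022StructureSelmer, §1.2.2 and §1.4.3 (PDF p. 7)] [cite: Wuthrich2014, Lemma 20 (p. 399) and Prop. 21 (p. 400)]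
[cite: MazurTateTeitelbaum1986Invent, §I.8 (8.6)] [cite: CremonaAlgorithms1997, §2.8 (2.8.8) (PDF p. 26)]
[cite: SilvermanAEC2009, III.1, VII.1 Remark 1.1, VII.5 Prop. 5.1(a)] [cite: IrelandRosen1990, Prop. 5.1.2 and §8.1]
[cite: Miller2011LMS, Def. 1.1] -/
theorem X8RankZero.bsdp_three_of_kim2025_OPEN_of_ainvs_of_certifiedOddL_of_LValueBall
    (hK25s : Kim2025.thm11_kimShaLength_of_integralPeriod_OPEN) (hW : sha_dvd_analyticSha)
    (hGZK : rank_eq_analyticRank_of_analyticRank_le_one) (hmod : hasEntireLFunction_rat)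
    (h3per : realPeriodRat_eq_unit_mul_plusPeriod_three)
    (a1 a2 a3 a4 a6 : ℤ) (hmin : (⟨a1, a2, a3, a4, a6⟩ : WeierstrassCurve ℚ).IsGloballyMinimal)
    (h3Δ : ¬ (3 : ℤ) ∣ discOf [a1, a2, a3, a4, a6]) {n₃ : ℕ}
    (hc₃ : countPoints [a1, a2, a3, a4, a6] 3 = n₃) (hn17 : n₃ = 1 ∨ n₃ = 7)
    (hsurj : Surj (⟨a1, a2, a3, a4, a6⟩ : WeierstrassCurve ℚ) 3)
    -- the landed twist record (`p = 3`, two level primes) and its rounding certificate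
    {rs : List TwistRecord} (hrs : CertifiedOddL rs) {r : TwistRecord} (hr : r ∈ rs) [Fact r.p.Prime]
    (hrp : r.p = 3) (hν : r.primes.length = 2)
    {c : RoundingCert} (hcv : c.validHasse = true)
    (hcp : c.p = r.p) (hcn : c.n = r.n) (hcden : c.den = r.den) (hcbins : c.bins = r.bins) (hD' : 0 < c.dstar)
    -- the cyclic Kolyvagin level `r.n = ℓ₁ · ℓ₂ ∈ 𝒩₁` from point counts and cube tests
    (ℓ₁ ℓ₂ : ℕ) (hne : ℓ₁ ≠ ℓ₂) (h5₁ : 5 ≤ ℓ₁) (h5₂ : 5 ≤ ℓ₂)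
    (hΔ₁ : ¬ (ℓ₁ : ℤ) ∣ discOf [a1, a2, a3, a4, a6]) (hΔ₂ : ¬ (ℓ₂ : ℤ) ∣ discOf [a1, a2, a3, a4, a6])
    (h1₁ : ℓ₁ ≡ 1 [MOD 3 ^ 1]) (h1₂ : ℓ₂ ≡ 1 [MOD 3 ^ 1]) {m₁ m₂ : ℕ}
    (hcnt₁ : Nat.card (((⟨a1, a2, a3, a4, a6⟩ : WeierstrassCurve ℤ).map
      (Int.castRingHom (ZMod ℓ₁))).toAffine.Point) = m₁)
    (hcnt₂ : Nat.card (((⟨a1, a2, a3, a4, a6⟩ : WeierstrassCurve ℤ).map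
      (Int.castRingHom (ZMod ℓ₂))).toAffine.Point) = m₂)
    (hd₁ : 3 ^ 1 ∣ m₁) (hd₂ : 3 ^ 1 ∣ m₂)
    (hz₁ : ((discOf [a1, a2, a3, a4, a6] : ℤ) : ZMod ℓ₁) ≠ 0)
    (hχ₁ : ((discOf [a1, a2, a3, a4, a6] : ℤ) : ZMod ℓ₁) ^ ((ℓ₁ - 1) / 3) ≠ 1)
    (hz₂ : ((discOf [a1, a2, a3, a4, a6] : ℤ) : ZMod ℓ₂) ≠ 0)
    (hχ₂ : ((discOf [a1, a2, a3, a4, a6] : ℤ) : ZMod ℓ₂) ^ ((ℓ₂ - 1) / 3) ≠ 1)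
    [hℓ₁ : Fact ℓ₁.Prime] [hℓ₂ : Fact ℓ₂.Prime] [hrn0 : NeZero r.n] (hrn : ℓ₁ * ℓ₂ = r.n)
    {A : ℤ} (hA : A = ((ℓ₁ : ℤ) + 1 - m₁ - 2) * ((ℓ₂ : ℤ) + 1 - m₂ - 2))
    -- the discrete logarithms
    (ψ₁ : (ZMod ℓ₁)ˣ →* Multiplicative (ZMod (r.p ^ 1))) (hψ₁ : Function.Surjective ψ₁)
    (ψ₂ : (ZMod ℓ₂)ˣ →* Multiplicative (ZMod (r.p ^ 1))) (hψ₂ : Function.Surjective ψ₂)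
    -- data binders
    (hr0 : (⟨a1, a2, a3, a4, a6⟩ : WeierstrassCurve ℚ).analyticRank = 0)
    {N : ℕ} [NeZero N] (D : ModularParametrizationData (⟨a1, a2, a3, a4, a6⟩ : WeierstrassCurve ℚ) N)
    -- the engine's enclosure claim, through twisted L-values
    (hballL : ∀ (L : ZMod (r.p ^ 1) → ℂ → ℂ), (∀ j, j ≠ 0 → Differentiable ℂ (L j)) →
      (∀ j, j ≠ 0 → ∀ s : ℂ, 2 < s.re →
        L j s = twistedLSeries D.f (binChar r.n (pairLogs ℓ₁ ℓ₂ ψ₁ ψ₂) j)⁻¹ s) →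
      ∀ k < r.p, ∃ mid rad : ℝ, rad ≤ (c.radNum : ℝ) / 10 ^ c.radExp ∧
        |mid - ((c.binsStar.getD k 0 : ℤ) : ℝ)| ≤ (c.marNum : ℝ) / 10 ^ c.marExp ∧
        |(c.dstar : ℝ) * ((r.components : ℝ) *
          (((A : ℂ) * (⟨a1, a2, a3, a4, a6⟩ : WeierstrassCurve ℚ).entireLFunction 1 +
            ∑ j ∈ (Finset.univ : Finset (ZMod (r.p ^ 1))).erase 0,
              ZMod.stdAddChar (-(j * (k : ZMod (r.p ^ 1)))) *
                (gaussSum (binChar r.n (pairLogs ℓ₁ ℓ₂ ψ₁ ψ₂) j) (ZMod.stdAddChar (N := r.n)) * L j 1)).re /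
            ((r.p ^ 1 : ℕ) * plusPeriod D.f))) - mid| ≤ rad) :
    BSDp (⟨a1, a2, a3, a4, a6⟩ : WeierstrassCurve ℚ) 3 := by
  have h0 : discOf [a1, a2, a3, a4, a6] ≠ 0 := fun h ↦ h3Δ (by rw [h]; exact dvd_zero _)
  haveI := isElliptic_of_discOf_ne_zero a1 a2 a3 a4 a6 h0
  haveI := hmin
  haveI : Fact (Nat.Prime 3) := ⟨by norm_num⟩
  have hI : integralModelInt (⟨a1, a2, a3, a4, a6⟩ : WeierstrassCurve ℚ) = ⟨a1, a2, a3, a4, a6⟩ :=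
    integralModelInt_eq_of_map_eq _ (map_mk_int a1 a2 a3 a4 a6)
  have hΔ₁' : ((⟨a1, a2, a3, a4, a6⟩ : WeierstrassCurve ℤ).map (Int.castRingHom (ZMod ℓ₁))).Δ =
      ((discOf [a1, a2, a3, a4, a6] : ℤ) : ZMod ℓ₁) := by
    rw [WeierstrassCurve.map_Δ, intCurve_Δ, eq_intCast]
  have hΔ₂' : ((⟨a1, a2, a3, a4, a6⟩ : WeierstrassCurve ℤ).map (Int.castRingHom (ZMod ℓ₂))).Δ =
      ((discOf [a1, a2, a3, a4, a6] : ℤ) : ZMod ℓ₂) := by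
    rw [WeierstrassCurve.map_Δ, intCurve_Δ, eq_intCast]
  -- class X8 at `3`
  have hX : ClassX8 (⟨a1, a2, a3, a4, a6⟩ : WeierstrassCurve ℚ) 3 :=
    classX8_of_intModel hI (by rw [intCurve_Δ]; exact h3Δ)
      (natCard_point_eq_of_countPoints a1 a2 a3 a4 a6 3 (by decide) h3Δ hc₃) hn17
  -- the cyclic Kolyvagin level `ℓ₁ℓ₂ ∈ 𝒩₁` from the two point counts and the cube tests
  have hcyc3 : IsCyclicKolyvaginLevel (⟨a1, a2, a3, a4, a6⟩ : WeierstrassCurve ℚ) 3 (ℓ₁ * ℓ₂) :=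
    isCyclicKolyvaginLevel_pair_of_intModel_of_cube hI (k := 1) le_rfl ℓ₁ ℓ₂ hne h5₁ h5₂
      (by rw [intCurve_Δ]; exact hΔ₁) (by rw [intCurve_Δ]; exact hΔ₂) h1₁ h1₂ hcnt₁ hcnt₂ hd₁ hd₂
      (by rw [hΔ₁']; exact hz₁) (by rw [hΔ₁']; exact hχ₁) (by rw [hΔ₂']; exact hz₂) (by rw [hΔ₂']; exact hχ₂)
  have hcyc : IsCyclicKolyvaginLevel (⟨a1, a2, a3, a4, a6⟩ : WeierstrassCurve ℚ) r.p r.n := by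
    rw [hrp, ← hrn]; exact hcyc3
  -- `#(prime factors of r.n) = #primes`
  have hν' : r.n.primeFactors.card = r.primes.length := by
    rw [← hrn, hν, Nat.primeFactors_mul hℓ₁.out.ne_zero hℓ₂.out.ne_zero, hℓ₁.out.primeFactors,
      hℓ₂.out.primeFactors, show ({ℓ₁} ∪ {ℓ₂} : Finset ℕ) = {ℓ₁, ℓ₂} from rfl, Finset.card_pair hne]
  -- the discrete logarithms
  have hψ : ∀ ℓ ∈ r.n.primeFactors, Function.Surjective (pairLogs ℓ₁ ℓ₂ ψ₁ ψ₂ ℓ) := by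
    rw [← hrn]
    exact surjective_pairLogs_of_mem_primeFactors ψ₁ ψ₂ hℓ₁.out hℓ₂.out hne hψ₁ hψ₂
  -- the certificate row as a one-element `RoundingCertifiedHasse` list
  have hcs : RoundingCertifiedHasse [c] :=
    (RoundingCertifiedHasse.cons_iff c []).2 ⟨hcv, RoundingCertifiedHasse.nil⟩
  -- `A = Π_{ℓ ∣ n} (a_ℓ − 2)`
  have hprod : (∏ ℓ ∈ r.n.primeFactors,
      (((⟨a1, a2, a3, a4, a6⟩ : WeierstrassCurve ℚ).frobeniusTrace ℓ : ℂ) - 2)) = (A : ℂ) := by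
    rw [← hrn]; exact prod_primeFactors_frobeniusTrace_sub_two_eq hI hℓ₁.out hℓ₂.out hne hcnt₁ hcnt₂ hA
  refine X8RankZero.bsdp_three_of_kim2025_OPEN_of_certifiedOddL_of_LValueBall _ hK25s hW hGZK hmod h3per hr0 hX
    hsurj D hrs hr hrp hν' hcyc hcs (List.mem_singleton_self c) hcp hcn hcden hcbins hD' (pairLogs ℓ₁ ℓ₂ ψ₁ ψ₂) hψ ?_
  intro L hL hL' k hk
  obtain ⟨mid, rad, h1, h2, h3⟩ := hballL L hL hL' k hk
  refine ⟨mid, rad, h1, h2, ?_⟩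
  rw [hprod]
  exact h3

end Summit.BirchSwinnertonDyer.Rank1Residual.Supersingular

end
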